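import Mathlib.MeasureTheory.Integral.Prod
import Mathlib.MeasureTheory.Constructions.Pi
import Mathlib.MeasureTheory.Measure.Haar.InnerProductSpace
import Mathlib.MeasureTheory.Constructions.BorelSpace.Metrizable
import Mathlib.Analysis.SpecialFunctions.Exponential
import Mathlib.Analysis.SpecificLimits.Normed
import HarnessLib

/-!
# The Kirkwood–Salsburg equations of the hard-sphere gas: the infinite-volume correlation
# functions at small density as the fixed point of a contraction

Topic `Literature/MathematicalPhysics/StatisticalMechanics`.  Ruelle's integral-equation method
(Ruelle 1969, §4.2, Theorem 4.2.3) specialised to the HARD-SPHERE gas in a finite-dimensional real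
inner product space `E` (unit exclusion distance), in the DENSITY normalisation used by the
canonical low-density theory of the tree (`KineticTheory/HardSphereEulerRatio`): writing the
`k`-point correlation function as `ρ_k = ρ^k g_k`, the Kirkwood–Salsburg equations
(Ruelle (2.12)–(2.13); for hard spheres `B = 0`, `C(β) = v₁ = vol B(0,1)`,
`K(x₁, (y)_n) = (−1)^n ∏ 𝟙[‖y_j − x₁‖ < 1]`, `e^{−βW¹(x)} = 𝟙[x₁ is at distance ≥ 1 from x₂ … x_m]`)
read, for `m ≥ 0` and `x = (x₁, x') ∈ E × E^m`,

  `g_{m+1}(x) = R · 𝟙[wall] · ∑_{n ≥ 0} (−ρ)^n/n! ∫_{B(x₁,1)^n} g_{m+n}(x', y) dy`,   `g_0 = 1`,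

with `ρ` the density and `R = z/ρ` the activity-to-density ratio (the inverse insertion
probability).  This file proves:

* `ksOp ρ R` — the (affine) Kirkwood–Salsburg operator on sequences `φ = (φ_k)_{k ≥ 0}` of functions
  of `k`-point configurations `Fin k → E`; `ksOp_zero`, `ksOp_succ`.
* A PRIORI BOUNDS in Ruelle's weighted sup-norm `sup_k ξ^{-k} ‖φ_k‖_∞` (Ruelle (2.14), (2.19), (2.25)),
  stated pointwise (no norm structure is built): if `|φ_k| ≤ C ξ^k` then
  `|(ksOp φ)_{m+1}| ≤ |R| ξ⁻¹ e^{|ρ| v₁ ξ} · C ξ^{m+1}` (`abs_ksOp_succ_le`), and the operator is a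
  CONTRACTION with ratio `θ = |R| ξ⁻¹ exp(|ρ| v₁ ξ)` (`abs_ksOp_sub_ksOp_le`); measurability is
  propagated (`measurable_ksOp`).
* THE FIXED POINT (Ruelle Thm 4.2.3, (2.29)): for `θ < 1` the iterates from `φ⁰ = (1, 0, 0, …)`
  converge, in the weighted sup-norm, to `ksCorr ρ R` — a measurable solution of
  `ksOp ρ R g = g` with `|g_k| ≤ ξ^k` (`ksOp_ksCorr`, `abs_ksCorr_le`), UNIQUE among bounded
  measurable solutions (`eq_ksCorr_of_fixed`), with the quantitative STABILITY estimate
  `|ψ_k − g_k| ≤ δ (1 − θ)⁻¹ ξ^k` whenever `|(ksOp ψ)_k − ψ_k| ≤ δ ξ^k` (`abs_sub_ksCorr_le`) by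
  which finite-volume / canonical correlation functions are compared with `g`.
* SYMMETRIES: `g` is invariant under every linear isometry and every translation of `E`
  (`ksCorr_linearIsometryEquiv`, `ksCorr_const_add`, from `ksOp_comp` and uniqueness).
* CONTINUITY IN THE PARAMETERS: `(ρ, R) ↦ g` is Lipschitz in the weighted sup-norm on bounded
  parameter sets (`abs_ksCorr_sub_ksCorr_le`).

The physical solution has `R = R(ρ)` fixed by `g_1 ≡ 1`; here `R` is a free parameter (the
canonical theory of the tree supplies `R = ratioLimit`).  Symmetry of `g_k` under permutations of
its arguments is NOT proved here (it follows from uniqueness once `g` is identified as a limit of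
symmetric finite-volume functions, as in Ruelle's proof).

## References

* D. Ruelle, *Statistical Mechanics: Rigorous Results*, Benjamin 1969, §4.2.1–4.2.3
  (eqs. (2.12)–(2.14), (2.17)–(2.19), (2.25)–(2.31), Theorem 4.2.3).  [Ruelle1969]

## Not here

No finite-volume or canonical statement, no identification of `R(ρ)`, no cluster / Mayer series.
-/

noncomputable section

open MeasureTheory Filter Set Metric
open scoped Topology BigOperators ENNReal

namespace Literature.MathematicalPhysics.StatisticalMechanics

namespace HardSphereKS

/-! ## Configurations, the Mayer factor and the hard wall (metric structure only) -/

section Metric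

variable {E : Type*} [NormedAddCommGroup E]

/-- A sequence of functions of `k`-point configurations, `k ≥ 0` (Ruelle's `φ = (φ(x)_n)`,
extended by a `0`-point component). [cite: Ruelle1969, §4.2.2 (2.14)] -/
abbrev CorrSeq (E : Type*) : Type _ := (k : ℕ) → (Fin k → E) → ℝ

/-- The Mayer kernel factor of the hard-sphere gas up to sign: `𝟙[all y_j ∈ B(a, 1)]`
(`K(a, (y)_n) = (−1)^n ∏_j 𝟙[‖y_j − a‖ < 1]`, Ruelle (2.9)). [cite: Ruelle1969, §4.2.1 (2.9)] -/
def ballProd (a : E) {n : ℕ} (y : Fin n → E) : ℝ :=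
  if ∀ j, dist (y j) a < 1 then 1 else 0

/-- The hard wall factor `e^{−βW¹(x)} = 𝟙[dist(x_{i+1}, x_0) ≥ 1 for all i]` (Ruelle (2.6)).
[cite: Ruelle1969, §4.2.1 (2.6)] -/
def wall {m : ℕ} (x : Fin (m + 1) → E) : ℝ :=
  if ∀ i : Fin m, 1 ≤ dist (x i.succ) (x 0) then 1 else 0

/-- `ballProd a` is the indicator of the product of unit balls `B(a,1)^n`. [folklore] -/
theorem ballProd_apply_eq_indicator (a : E) {n : ℕ} (y : Fin n → E) :
    ballProd a y = (Set.pi univ fun _ : Fin n => ball a 1).indicator 1 y := by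
  unfold ballProd
  by_cases h : ∀ j, dist (y j) a < 1
  · rw [if_pos h, indicator_of_mem (by simpa [Set.mem_univ_pi] using h)]; rfl
  · rw [if_neg h, indicator_of_notMem (by simpa [Set.mem_univ_pi] using h)]

/-- `ballProd a` is the indicator of `B(a,1)^n` (function form). [folklore] -/
theorem ballProd_eq_indicator (a : E) (n : ℕ) :
    (fun y : Fin n → E => ballProd a y) = (Set.pi univ fun _ : Fin n => ball a 1).indicator 1 :=
  funext fun y => ballProd_apply_eq_indicator a y

/-- `0 ≤ ballProd`. [folklore] -/
theorem ballProd_nonneg (a : E) {n : ℕ} (y : Fin n → E) : 0 ≤ ballProd a y := by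
  unfold ballProd; split_ifs <;> norm_num

/-- `ballProd ≤ 1`. [folklore] -/
theorem ballProd_le_one (a : E) {n : ℕ} (y : Fin n → E) : ballProd a y ≤ 1 := by
  unfold ballProd; split_ifs <;> norm_num

/-- `|ballProd| ≤ 1`. [folklore] -/
theorem abs_ballProd_le_one (a : E) {n : ℕ} (y : Fin n → E) : |ballProd a y| ≤ 1 := by
  rw [abs_of_nonneg (ballProd_nonneg a y)]; exact ballProd_le_one a y

/-- `0 ≤ wall`. [folklore] -/
theorem wall_nonneg {m : ℕ} (x : Fin (m + 1) → E) : 0 ≤ wall x := by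
  unfold wall; split_ifs <;> norm_num

/-- `wall ≤ 1`. [folklore] -/
theorem wall_le_one {m : ℕ} (x : Fin (m + 1) → E) : wall x ≤ 1 := by
  unfold wall; split_ifs <;> norm_num

/-- `|wall| ≤ 1`. [folklore] -/
theorem abs_wall_le_one {m : ℕ} (x : Fin (m + 1) → E) : |wall x| ≤ 1 := by
  rw [abs_of_nonneg (wall_nonneg x)]; exact wall_le_one x

/-- The continuity of `y ↦ (x', y)` (`Fin.append` of a fixed prefix). [folklore] -/
theorem continuous_append_right {m n : ℕ} (a : Fin m → E) :
    Continuous fun y : Fin n → E => Fin.append a y :=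
  (Fin.appendHomeomorph (X := E) m n).continuous.comp (Continuous.prodMk_right a)

/-- Continuity of `x ↦ tail x`. [folklore] -/
theorem continuous_tail {m : ℕ} : Continuous fun x : Fin (m + 1) → E => Fin.tail x :=
  continuous_pi fun i : Fin m => continuous_apply (Fin.succ i)

/-- Joint continuity of `(x, y) ↦ (tail x, y)` appended. [folklore] -/
theorem continuous_append_tail {m n : ℕ} :
    Continuous fun p : (Fin (m + 1) → E) × (Fin n → E) => Fin.append (Fin.tail p.1) p.2 :=
  (Fin.appendHomeomorph (X := E) m n).continuous.comp
    ((continuous_tail.comp continuous_fst).prodMk continuous_snd)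

variable [MeasurableSpace E] [BorelSpace E]

/-- `B(a,1)^n` is measurable. [folklore] -/
theorem measurableSet_ballPi (a : E) (n : ℕ) :
    MeasurableSet (Set.pi univ fun _ : Fin n => ball a 1) :=
  MeasurableSet.univ_pi fun _ => measurableSet_ball

/-- `ballProd a` is measurable. [folklore] -/
theorem measurable_ballProd (a : E) (n : ℕ) : Measurable fun y : Fin n → E => ballProd a y := by
  rw [ballProd_eq_indicator]
  exact measurable_one.indicator (measurableSet_ballPi a n)

end Metric

/-! ## The Kirkwood–Salsburg operator -/

variable {E : Type*} [NormedAddCommGroup E] [InnerProductSpace ℝ E] [FiniteDimensional ℝ E]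
  [MeasurableSpace E] [BorelSpace E]

variable (E) in
/-- The volume `v₁` of the unit ball of `E` (Ruelle's `C(β)` for hard spheres). [folklore] -/
def v1 : ℝ := (volume : Measure E).real (ball (0 : E) 1)

/-- The integrand of the `n`-th Kirkwood–Salsburg term at the configuration `x = (x₀, x')`:
`𝟙[y ⊂ B(x₀,1)] φ_{m+n}(x', y)`. [cite: Ruelle1969, §4.2.1 (2.13)] -/
def ksIntegrand (φ : CorrSeq E) (m n : ℕ) (x : Fin (m + 1) → E) (y : Fin n → E) : ℝ :=
  ballProd (x 0) y * φ (m + n) (Fin.append (Fin.tail x) y)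

/-- The `n`-th Kirkwood–Salsburg term `(−ρ)^n/n! ∫_{B(x₀,1)^n} φ_{m+n}(x', y) dy`.
[cite: Ruelle1969, §4.2.1 (2.13)] -/
def ksTerm (ρ : ℝ) (φ : CorrSeq E) (m n : ℕ) (x : Fin (m + 1) → E) : ℝ :=
  (-ρ) ^ n / (Nat.factorial n : ℝ) * ∫ y : Fin n → E, ksIntegrand φ m n x y

/-- **The Kirkwood–Salsburg operator** of the hard-sphere gas at density `ρ` and ratio `R`
(density normalisation `ρ_k = ρ^k g_k`): `(T φ)_0 = 1`,
`(T φ)_{m+1}(x) = R 𝟙[wall(x)] ∑_n (−ρ)^n/n! ∫_{B(x₀,1)^n} φ_{m+n}(x', y) dy`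
(Ruelle (2.12)–(2.13), (2.20) with `z = ρR` and the `ρ^k` scaling). [cite: Ruelle1969, §4.2.1 (2.20)] -/
def ksOp (ρ R : ℝ) (φ : CorrSeq E) : CorrSeq E
  | 0 => fun _ => 1
  | m + 1 => fun x => R * wall x * ∑' n, ksTerm ρ φ m n x

/-- `(T φ)_0 = 1`. [cite: Ruelle1969, §4.2.1 (2.20)] -/
@[simp] theorem ksOp_zero (ρ R : ℝ) (φ : CorrSeq E) (x : Fin 0 → E) : ksOp ρ R φ 0 x = 1 := rfl

/-- `(T φ)_{m+1}(x) = R · wall(x) · ∑_n ksTerm`. [cite: Ruelle1969, §4.2.1 (2.20)] -/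
theorem ksOp_succ (ρ R : ℝ) (φ : CorrSeq E) (m : ℕ) (x : Fin (m + 1) → E) :
    ksOp ρ R φ (m + 1) x = R * wall x * ∑' n, ksTerm ρ φ m n x := rfl

/-! ## The basic integral bound -/

/-- `0 < v₁`. [folklore] -/
theorem v1_pos : 0 < v1 E := by
  rw [v1, measureReal_def]
  exact ENNReal.toReal_pos (measure_ball_pos volume (0 : E) one_pos).ne' measure_ball_lt_top.ne

/-- `0 ≤ v₁`. [folklore] -/
theorem v1_nonneg : 0 ≤ v1 E := v1_pos.le

/-- `vol (B(a,1)^n) = v₁^n`. [folklore] -/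
theorem volume_real_ballPi (a : E) (n : ℕ) :
    (volume : Measure (Fin n → E)).real (Set.pi univ fun _ : Fin n => ball a 1) = v1 E ^ n := by
  rw [measureReal_def, volume_pi, Measure.pi_pi]
  simp only [Finset.prod_const, Finset.card_univ, Fintype.card_fin]
  rw [Measure.addHaar_ball_center volume a, ENNReal.toReal_pow]
  rfl

/-- `B(a,1)^n` has finite volume. [folklore] -/
theorem volume_ballPi_lt_top (a : E) (n : ℕ) :
    (volume : Measure (Fin n → E)) (Set.pi univ fun _ : Fin n => ball a 1) < ∞ := by
  rw [volume_pi, Measure.pi_pi]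
  exact ENNReal.prod_lt_top fun _ _ => measure_ball_lt_top

/-- **The basic integral bound** `|∫ 𝟙[y ⊂ B(a,1)] F(y) dy| ≤ v₁^n · sup |F|` (no measurability of
`F` is needed: a non-integrable integrand has integral `0`). [cite: Ruelle1969, §4.2.2 (2.19)] -/
theorem abs_integral_ballProd_mul_le (a : E) {n : ℕ} {F : (Fin n → E) → ℝ} {M : ℝ}
    (hF : ∀ y, |F y| ≤ M) : |∫ y, ballProd a y * F y| ≤ v1 E ^ n * M := by
  have hS := measurableSet_ballPi a n
  calc |∫ y, ballProd a y * F y| ≤ ∫ y, |ballProd a y * F y| := abs_integral_le_integral_abs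
    _ ≤ ∫ y, (Set.pi univ fun _ : Fin n => ball a 1).indicator (fun _ => M) y := by
        refine integral_mono_of_nonneg (Eventually.of_forall fun y => abs_nonneg _)
          ((integrable_indicator_iff hS).2 (integrableOn_const (volume_ballPi_lt_top a n).ne))
          (Eventually.of_forall fun y => ?_)
        show |ballProd a y * F y| ≤ _
        rw [ballProd_apply_eq_indicator, abs_mul]
        by_cases hy : y ∈ Set.pi univ fun _ : Fin n => ball a 1
        · rw [indicator_of_mem hy, indicator_of_mem hy, Pi.one_apply, abs_one, one_mul]; exact hF y
        · rw [indicator_of_notMem hy, indicator_of_notMem hy, abs_zero, zero_mul]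
    _ = v1 E ^ n * M := by
        rw [integral_indicator_const _ hS, volume_real_ballPi, smul_eq_mul]


/-! ## Ruelle's a priori bounds (weighted sup-norm, stated pointwise) -/

/-- **Term bound**: `|(−ρ)^n/n! ∫_{B(x₀)^n} φ_{m+n}(x',y) dy| ≤ |ρ|^n/n! · v₁^n · sup|φ_{m+n}|`.
[cite: Ruelle1969, §4.2.2 (2.19)] -/
theorem abs_ksTerm_le (ρ : ℝ) {φ : CorrSeq E} {m n : ℕ} {M : ℝ} (hM : ∀ y, |φ (m + n) y| ≤ M)
    (x : Fin (m + 1) → E) :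
    |ksTerm ρ φ m n x| ≤ |ρ| ^ n / (Nat.factorial n : ℝ) * (v1 E ^ n * M) := by
  unfold ksTerm ksIntegrand
  rw [abs_mul, abs_div, abs_pow, abs_neg, Nat.abs_cast]
  exact mul_le_mul_of_nonneg_left (abs_integral_ballProd_mul_le (x 0) fun y => hM _) (by positivity)

/-- **Term bound in the weighted class**: if `|φ_k| ≤ C ξ^k` for all `k` then
`|ksTerm_n| ≤ C ξ^m (|ρ| v₁ ξ)^n / n!`. [cite: Ruelle1969, §4.2.2 (2.19)] -/
theorem abs_ksTerm_le_of_forall (ρ : ℝ) {φ : CorrSeq E} {ξ C : ℝ}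
    (hφ : ∀ k (y : Fin k → E), |φ k y| ≤ C * ξ ^ k) (m n : ℕ) (x : Fin (m + 1) → E) :
    |ksTerm ρ φ m n x| ≤ C * ξ ^ m * ((|ρ| * v1 E * ξ) ^ n / (Nat.factorial n : ℝ)) := by
  refine (abs_ksTerm_le ρ (fun y => hφ (m + n) y) x).trans (le_of_eq ?_)
  rw [pow_add, mul_pow, mul_pow]
  ring

/-- The exponential majorant: `∑_n C ξ^m (|ρ| v₁ ξ)^n/n! = C ξ^m exp(|ρ| v₁ ξ)`. [folklore] -/
theorem hasSum_majorant (ρ ξ C : ℝ) (m : ℕ) :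
    HasSum (fun n : ℕ => C * ξ ^ m * ((|ρ| * v1 E * ξ) ^ n / (Nat.factorial n : ℝ)))
      (C * ξ ^ m * Real.exp (|ρ| * v1 E * ξ)) := by
  have h := NormedSpace.expSeries_div_hasSum_exp (|ρ| * v1 E * ξ)
  rw [← congrFun Real.exp_eq_exp_ℝ (|ρ| * v1 E * ξ)] at h
  exact h.mul_left _

/-- **Summability of the Kirkwood–Salsburg series** in the weighted class. [cite: Ruelle1969, §4.2.2 (2.19)] -/
theorem summable_ksTerm (ρ : ℝ) {φ : CorrSeq E} {ξ C : ℝ}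
    (hφ : ∀ k (y : Fin k → E), |φ k y| ≤ C * ξ ^ k) (m : ℕ) (x : Fin (m + 1) → E) :
    Summable fun n => ksTerm ρ φ m n x :=
  Summable.of_norm_bounded (hasSum_majorant ρ ξ C m).summable
    fun n => (Real.norm_eq_abs _).le.trans (abs_ksTerm_le_of_forall ρ hφ m n x)

/-- **Bound on the series**: `|∑_n ksTerm_n| ≤ C ξ^m exp(|ρ| v₁ ξ)`. [cite: Ruelle1969, §4.2.2 (2.19)] -/
theorem abs_tsum_ksTerm_le (ρ : ℝ) {φ : CorrSeq E} {ξ C : ℝ}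
    (hφ : ∀ k (y : Fin k → E), |φ k y| ≤ C * ξ ^ k) (m : ℕ) (x : Fin (m + 1) → E) :
    |∑' n, ksTerm ρ φ m n x| ≤ C * ξ ^ m * Real.exp (|ρ| * v1 E * ξ) := by
  have h := tsum_of_norm_bounded (hasSum_majorant ρ ξ C m)
    fun n => (Real.norm_eq_abs _).le.trans (abs_ksTerm_le_of_forall ρ hφ m n x)
  rwa [Real.norm_eq_abs] at h

variable (E) in
/-- Ruelle's contraction ratio `θ = |R| ξ⁻¹ exp(|ρ| v₁ ξ)` (`‖zΠK‖_ξ ≤ |z| ξ⁻¹ exp(ξ C(β))` with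
`z = ρR`, after the `ρ^k` rescaling). [cite: Ruelle1969, §4.2.2 (2.25)] -/
def ksRatio (ρ R ξ : ℝ) : ℝ := |R| * ξ⁻¹ * Real.exp (|ρ| * v1 E * ξ)

/-- `0 ≤ θ`. [folklore] -/
theorem ksRatio_nonneg (ρ R : ℝ) {ξ : ℝ} (hξ : 0 ≤ ξ) : 0 ≤ ksRatio E ρ R ξ := by
  unfold ksRatio; positivity

/-- **A priori bound** `|(T φ)_{m+1}(x)| ≤ θ · C ξ^{m+1}` on the weighted class.
[cite: Ruelle1969, §4.2.2 (2.24)] -/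
theorem abs_ksOp_succ_le (ρ R : ℝ) {φ : CorrSeq E} {ξ C : ℝ} (hξ : 0 < ξ)
    (hφ : ∀ k (y : Fin k → E), |φ k y| ≤ C * ξ ^ k) (m : ℕ) (x : Fin (m + 1) → E) :
    |ksOp ρ R φ (m + 1) x| ≤ ksRatio E ρ R ξ * (C * ξ ^ (m + 1)) := by
  rw [ksOp_succ, abs_mul, abs_mul]
  have hC : 0 ≤ C := by
    have h0 := hφ 0 (fun i => Fin.elim0 i)
    rw [pow_zero, mul_one] at h0
    exact (abs_nonneg _).trans h0
  calc |R| * |wall x| * |∑' n, ksTerm ρ φ m n x|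
      ≤ |R| * 1 * (C * ξ ^ m * Real.exp (|ρ| * v1 E * ξ)) :=
        mul_le_mul (mul_le_mul_of_nonneg_left (abs_wall_le_one x) (abs_nonneg R))
          (abs_tsum_ksTerm_le ρ hφ m x) (abs_nonneg _) (by positivity)
    _ = ksRatio E ρ R ξ * (C * ξ ^ (m + 1)) := by
        unfold ksRatio; field_simp; ring

/-! ## Measurability and integrability -/

/-- The wall factor is measurable. [folklore] -/
theorem measurable_wall (m : ℕ) : Measurable fun x : Fin (m + 1) → E => wall x := by
  unfold wall
  refine Measurable.ite ?_ measurable_const measurable_const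
  rw [show {x : Fin (m + 1) → E | ∀ i : Fin m, 1 ≤ dist (x i.succ) (x 0)} =
      ⋂ i : Fin m, {x | 1 ≤ dist (x i.succ) (x 0)} by ext x; simp]
  exact MeasurableSet.iInter fun i =>
    measurableSet_le measurable_const ((measurable_pi_apply _).dist (measurable_pi_apply _))

/-- Joint measurability of the Kirkwood–Salsburg integrand. [folklore] -/
theorem measurable_ksIntegrand_uncurry {φ : CorrSeq E} (hφ : ∀ k, Measurable (φ k)) (m n : ℕ) :
    Measurable fun p : (Fin (m + 1) → E) × (Fin n → E) => ksIntegrand φ m n p.1 p.2 := by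
  unfold ksIntegrand
  refine Measurable.mul ?_ ((hφ (m + n)).comp continuous_append_tail.measurable)
  unfold ballProd
  refine Measurable.ite ?_ measurable_const measurable_const
  rw [show {p : (Fin (m + 1) → E) × (Fin n → E) | ∀ j, dist (p.2 j) (p.1 0) < 1} =
      ⋂ j : Fin n, {p | dist (p.2 j) (p.1 0) < 1} by ext p; simp]
  exact MeasurableSet.iInter fun j => measurableSet_lt
    (((measurable_pi_apply j).comp measurable_snd).dist ((measurable_pi_apply 0).comp measurable_fst))
    measurable_const

/-- Measurability of the integrand in `y`. [folklore] -/
theorem measurable_ksIntegrand {φ : CorrSeq E} (hφ : ∀ k, Measurable (φ k)) (m n : ℕ)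
    (x : Fin (m + 1) → E) : Measurable fun y => ksIntegrand φ m n x y :=
  (measurable_ksIntegrand_uncurry hφ m n).comp (Continuous.prodMk_right x).measurable

/-- **Integrability of the integrand** (bounded, measurable, supported in `B(x₀,1)^n`). [folklore] -/
theorem integrable_ksIntegrand {φ : CorrSeq E} (hφ : ∀ k, Measurable (φ k)) {m n : ℕ} {M : ℝ}
    (hM : ∀ y, |φ (m + n) y| ≤ M) (x : Fin (m + 1) → E) :
    Integrable fun y => ksIntegrand φ m n x y := by
  have hS := measurableSet_ballPi (x 0) n
  have heq : (fun y => ksIntegrand φ m n x y) =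
      (Set.pi univ fun _ : Fin n => ball (x 0) 1).indicator
        fun y => φ (m + n) (Fin.append (Fin.tail x) y) := by
    funext y
    unfold ksIntegrand
    rw [ballProd_apply_eq_indicator]
    by_cases hy : y ∈ Set.pi univ fun _ : Fin n => ball (x 0) 1
    · rw [indicator_of_mem hy, indicator_of_mem hy, Pi.one_apply, one_mul]
    · rw [indicator_of_notMem hy, indicator_of_notMem hy, zero_mul]
  rw [heq, integrable_indicator_iff hS]
  refine Measure.integrableOn_of_bounded (volume_ballPi_lt_top (x 0) n).ne
    (((hφ (m + n)).comp (continuous_append_right _).measurable).aestronglyMeasurable)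
    (M := M) (Eventually.of_forall fun y => ?_)
  rw [Real.norm_eq_abs]; exact hM _

/-- Measurability of `x ↦ ∫ ksIntegrand(x, y) dy`. [folklore] -/
theorem measurable_integral_ksIntegrand {φ : CorrSeq E} (hφ : ∀ k, Measurable (φ k)) (m n : ℕ) :
    Measurable fun x : Fin (m + 1) → E => ∫ y, ksIntegrand φ m n x y :=
  ((measurable_ksIntegrand_uncurry hφ m n).stronglyMeasurable.integral_prod_right'
    (ν := (volume : Measure (Fin n → E)))).measurable

/-- Measurability of the `n`-th term. [folklore] -/
theorem measurable_ksTerm (ρ : ℝ) {φ : CorrSeq E} (hφ : ∀ k, Measurable (φ k)) (m n : ℕ) :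
    Measurable fun x : Fin (m + 1) → E => ksTerm ρ φ m n x :=
  (measurable_integral_ksIntegrand hφ m n).const_mul _

/-- **Measurability is propagated by the operator** (on the weighted class, where the series
converges pointwise). [folklore] -/
theorem measurable_ksOp (ρ R : ℝ) {φ : CorrSeq E} {ξ C : ℝ}
    (hφm : ∀ k, Measurable (φ k)) (hφ : ∀ k (y : Fin k → E), |φ k y| ≤ C * ξ ^ k) (k : ℕ) :
    Measurable (ksOp ρ R φ k) := by
  cases k with
  | zero => exact measurable_const
  | succ m =>
    have hts : Measurable fun x : Fin (m + 1) → E => ∑' n, ksTerm ρ φ m n x := by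
      refine measurable_of_tendsto_metrizable
        (f := fun N x => ∑ n ∈ Finset.range N, ksTerm ρ φ m n x)
        (fun N => Finset.measurable_sum _ fun n _ => measurable_ksTerm ρ hφm m n) ?_
      rw [tendsto_pi_nhds]
      exact fun x => (summable_ksTerm ρ hφ m x).hasSum.tendsto_sum_nat
    exact ((measurable_wall m).const_mul R).mul hts


/-! ## The contraction property -/

/-- Linearity of the `n`-th term in `φ` (under integrability). [folklore] -/
theorem ksTerm_sub (ρ : ℝ) {φ ψ : CorrSeq E} (hφm : ∀ k, Measurable (φ k))
    (hψm : ∀ k, Measurable (ψ k)) {m n : ℕ} {M M' : ℝ} (hM : ∀ y, |φ (m + n) y| ≤ M)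
    (hM' : ∀ y, |ψ (m + n) y| ≤ M') (x : Fin (m + 1) → E) :
    ksTerm ρ φ m n x - ksTerm ρ ψ m n x = ksTerm ρ (φ - ψ) m n x := by
  unfold ksTerm
  rw [← mul_sub, ← integral_sub (integrable_ksIntegrand hφm hM x) (integrable_ksIntegrand hψm hM' x)]
  congr 1
  refine integral_congr_ae (Eventually.of_forall fun y => ?_)
  simp only [ksIntegrand, Pi.sub_apply]
  ring

/-- **The Kirkwood–Salsburg operator is a contraction** of ratio `θ = |R| ξ⁻¹ exp(|ρ| v₁ ξ)` in
Ruelle's weighted sup-norm, pointwise form: if `|φ_k − ψ_k| ≤ D ξ^k` for all `k` then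
`|(Tφ)_k − (Tψ)_k| ≤ θ D ξ^k` for all `k`. [cite: Ruelle1969, §4.2.2 (2.25)–(2.27)] -/
theorem abs_ksOp_sub_ksOp_le (ρ R : ℝ) {φ ψ : CorrSeq E} {ξ C C' D : ℝ} (hξ : 0 < ξ)
    (hφm : ∀ k, Measurable (φ k)) (hφ : ∀ k (y : Fin k → E), |φ k y| ≤ C * ξ ^ k)
    (hψm : ∀ k, Measurable (ψ k)) (hψ : ∀ k (y : Fin k → E), |ψ k y| ≤ C' * ξ ^ k)
    (hD : ∀ k (y : Fin k → E), |φ k y - ψ k y| ≤ D * ξ ^ k) (k : ℕ) (x : Fin k → E) :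
    |ksOp ρ R φ k x - ksOp ρ R ψ k x| ≤ ksRatio E ρ R ξ * (D * ξ ^ k) := by
  cases k with
  | zero =>
    simp only [ksOp_zero, sub_self, abs_zero]
    have hD0 : 0 ≤ D := by
      have h0 := hD 0 (fun i => Fin.elim0 i)
      rw [pow_zero, mul_one] at h0
      exact (abs_nonneg _).trans h0
    exact mul_nonneg (ksRatio_nonneg ρ R hξ.le) (by positivity)
  | succ m =>
    rw [ksOp_succ, ksOp_succ, ← mul_sub, abs_mul, abs_mul,
      ← (summable_ksTerm ρ hφ m x).tsum_sub (summable_ksTerm ρ hψ m x)]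
    have hsub : (fun n => ksTerm ρ φ m n x - ksTerm ρ ψ m n x) = fun n => ksTerm ρ (φ - ψ) m n x :=
      funext fun n => ksTerm_sub ρ hφm hψm (fun y => hφ _ y) (fun y => hψ _ y) x
    rw [hsub]
    have hD' : ∀ k (y : Fin k → E), |(φ - ψ) k y| ≤ D * ξ ^ k := fun k y => by
      rw [Pi.sub_apply, Pi.sub_apply]; exact hD k y
    calc |R| * |wall x| * |∑' n, ksTerm ρ (φ - ψ) m n x|
        ≤ |R| * 1 * (D * ξ ^ m * Real.exp (|ρ| * v1 E * ξ)) := by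
          have hD0 : 0 ≤ D * ξ ^ m * Real.exp (|ρ| * v1 E * ξ) :=
            (abs_nonneg _).trans (abs_tsum_ksTerm_le ρ hD' m x)
          exact mul_le_mul (mul_le_mul_of_nonneg_left (abs_wall_le_one x) (abs_nonneg R))
            (abs_tsum_ksTerm_le ρ hD' m x) (abs_nonneg _) (by positivity)
      _ = ksRatio E ρ R ξ * (D * ξ ^ (m + 1)) := by
          unfold ksRatio; field_simp; ring

/-- **The operator preserves the unit weighted ball** `{|φ_k| ≤ ξ^k}` once `θ ≤ 1`.
[cite: Ruelle1969, §4.2.2 (2.24)] -/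
theorem abs_ksOp_le_pow (ρ R : ℝ) {φ : CorrSeq E} {ξ : ℝ} (hξ : 0 < ξ)
    (hθ : ksRatio E ρ R ξ ≤ 1) (hφ : ∀ k (y : Fin k → E), |φ k y| ≤ ξ ^ k) (k : ℕ)
    (x : Fin k → E) : |ksOp ρ R φ k x| ≤ ξ ^ k := by
  cases k with
  | zero => simp
  | succ m =>
    have hφ' : ∀ k (y : Fin k → E), |φ k y| ≤ 1 * ξ ^ k := fun k y => by rw [one_mul]; exact hφ k y
    calc |ksOp ρ R φ (m + 1) x| ≤ ksRatio E ρ R ξ * (1 * ξ ^ (m + 1)) :=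
          abs_ksOp_succ_le ρ R hξ hφ' m x
      _ ≤ 1 * (1 * ξ ^ (m + 1)) := mul_le_mul_of_nonneg_right hθ (by positivity)
      _ = ξ ^ (m + 1) := by ring

/-! ## The fixed point: Ruelle's theorem for hard spheres -/

/-- The starting sequence `φ⁰ = (1, 0, 0, …)` of the iteration. [folklore] -/
def ksStart : CorrSeq E := fun k _ => if k = 0 then 1 else 0

/-- The Picard iterates `T^n φ⁰` (the partial Liouville–Neumann series of (2.29)).
[cite: Ruelle1969, §4.2.2 (2.29)] -/
def ksIter (ρ R : ℝ) (n : ℕ) : CorrSeq E := (ksOp ρ R)^[n] ksStart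

/-- **The infinite-volume correlation functions of the hard-sphere gas** at density `ρ` and ratio
`R` (density normalisation): the pointwise limit of the Picard iterates of the Kirkwood–Salsburg
operator — Ruelle's `ρ = (1 − zΠK)⁻¹ zα`, eq. (2.29); it is THE solution of the equations when the
contraction ratio is `< 1` (`ksOp_ksCorr`, `eq_ksCorr_of_fixed`), and an unspecified junk
limit otherwise. [cite: Ruelle1969, §4.2.3 Thm 4.2.3] -/
def ksCorr (ρ R : ℝ) : CorrSeq E := fun k x => limUnder atTop fun n => ksIter (E := E) ρ R n k x

/-- `T^0 φ⁰ = φ⁰`. [folklore] -/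
theorem ksIter_zero (ρ R : ℝ) : ksIter (E := E) ρ R 0 = ksStart := rfl

/-- `T^{n+1} φ⁰ = T (T^n φ⁰)`. [folklore] -/
theorem ksIter_succ (ρ R : ℝ) (n : ℕ) : ksIter (E := E) ρ R (n + 1) = ksOp ρ R (ksIter ρ R n) :=
  Function.iterate_succ_apply' _ _ _

omit [NormedAddCommGroup E] [InnerProductSpace ℝ E] [FiniteDimensional ℝ E] [BorelSpace E] in
/-- `φ⁰` is measurable. [folklore] -/
theorem measurable_ksStart (k : ℕ) : Measurable (ksStart (E := E) k) := measurable_const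

omit [NormedAddCommGroup E] [InnerProductSpace ℝ E] [FiniteDimensional ℝ E] [MeasurableSpace E]
  [BorelSpace E] in
/-- `|φ⁰_k| ≤ ξ^k` (`ξ ≥ 0`). [folklore] -/
theorem abs_ksStart_le {ξ : ℝ} (hξ : 0 ≤ ξ) (k : ℕ) (x : Fin k → E) : |ksStart k x| ≤ ξ ^ k := by
  unfold ksStart
  split_ifs with h
  · subst h; simp
  · rw [abs_zero]; positivity

section FixedPoint

variable {ρ R ξ : ℝ} (hξ : 0 < ξ) (hθ : ksRatio E ρ R ξ < 1)
include hξ hθ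

/-- The iterates stay in the unit weighted ball. [cite: Ruelle1969, §4.2.2 (2.24)] -/
theorem abs_ksIter_le (n k : ℕ) (x : Fin k → E) : |ksIter ρ R n k x| ≤ ξ ^ k := by
  induction n generalizing k x with
  | zero => exact abs_ksStart_le hξ.le k x
  | succ n ih => rw [ksIter_succ]; exact abs_ksOp_le_pow ρ R hξ hθ.le ih k x

/-- The iterates are measurable. [folklore] -/
theorem measurable_ksIter (n k : ℕ) : Measurable (ksIter (E := E) ρ R n k) := by
  induction n generalizing k with
  | zero => exact measurable_ksStart k
  | succ n ih =>
    rw [ksIter_succ]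
    have hb : ∀ k (y : Fin k → E), |ksIter (E := E) ρ R n k y| ≤ 1 * ξ ^ k := fun k y => by
      rw [one_mul]; exact abs_ksIter_le hξ hθ n k y
    exact measurable_ksOp ρ R ih hb k

/-- **Geometric decay of successive differences**: `|T^{n+1}φ⁰ − T^nφ⁰| ≤ 2 θ^n ξ^k`.
[cite: Ruelle1969, §4.2.2 (2.29)] -/
theorem abs_ksIter_succ_sub_le (n k : ℕ) (x : Fin k → E) :
    |ksIter ρ R (n + 1) k x - ksIter ρ R n k x| ≤ 2 * ksRatio E ρ R ξ ^ n * ξ ^ k := by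
  induction n generalizing k x with
  | zero =>
    rw [pow_zero, mul_one]
    calc |ksIter ρ R (0 + 1) k x - ksIter ρ R 0 k x|
        ≤ |ksIter ρ R (0 + 1) k x| + |ksIter ρ R 0 k x| := abs_sub _ _
      _ ≤ ξ ^ k + ξ ^ k := add_le_add (abs_ksIter_le hξ hθ _ k x) (abs_ksIter_le hξ hθ _ k x)
      _ = 2 * ξ ^ k := by ring
  | succ n ih =>
    rw [ksIter_succ ρ R (n + 1)]
    nth_rw 2 [ksIter_succ ρ R n]
    have h1 : ∀ k (y : Fin k → E), |ksIter (E := E) ρ R (n + 1) k y| ≤ 1 * ξ ^ k := fun k y => by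
      rw [one_mul]; exact abs_ksIter_le hξ hθ _ k y
    have h0 : ∀ k (y : Fin k → E), |ksIter (E := E) ρ R n k y| ≤ 1 * ξ ^ k := fun k y => by
      rw [one_mul]; exact abs_ksIter_le hξ hθ _ k y
    calc |ksOp ρ R (ksIter ρ R (n + 1)) k x - ksOp ρ R (ksIter ρ R n) k x|
        ≤ ksRatio E ρ R ξ * (2 * ksRatio E ρ R ξ ^ n * ξ ^ k) :=
          abs_ksOp_sub_ksOp_le ρ R hξ (measurable_ksIter hξ hθ _) h1 (measurable_ksIter hξ hθ _) h0
            (fun k y => by rw [mul_assoc]; exact (ih k y).trans (le_of_eq (by ring))) k x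
      _ = 2 * ksRatio E ρ R ξ ^ (n + 1) * ξ ^ k := by ring

/-- **Convergence of the iteration** (pointwise; the Liouville–Neumann series converges).
[cite: Ruelle1969, §4.2.3 Thm 4.2.3] -/
theorem tendsto_ksIter (k : ℕ) (x : Fin k → E) :
    Tendsto (fun n => ksIter ρ R n k x) atTop (𝓝 (ksCorr ρ R k x)) := by
  have hu : ∀ n, dist (ksIter ρ R n k x) (ksIter ρ R (n + 1) k x) ≤
      2 * ξ ^ k * ksRatio E ρ R ξ ^ n := fun n => by
    rw [dist_comm, Real.dist_eq]
    exact (abs_ksIter_succ_sub_le hξ hθ n k x).trans (le_of_eq (by ring))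
  exact tendsto_nhds_limUnder (cauchySeq_tendsto_of_complete (cauchySeq_of_le_geometric _ _ hθ hu))

/-- **Rate of convergence**: `|g_k − (T^nφ⁰)_k| ≤ 2 θ^n (1 − θ)⁻¹ ξ^k`. [cite: Ruelle1969, §4.2.3 Thm 4.2.3] -/
theorem abs_ksCorr_sub_ksIter_le (n k : ℕ) (x : Fin k → E) :
    |ksCorr ρ R k x - ksIter ρ R n k x| ≤
      2 * ksRatio E ρ R ξ ^ n / (1 - ksRatio E ρ R ξ) * ξ ^ k := by
  have hu : ∀ n, dist (ksIter ρ R n k x) (ksIter ρ R (n + 1) k x) ≤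
      2 * ξ ^ k * ksRatio E ρ R ξ ^ n := fun n => by
    rw [dist_comm, Real.dist_eq]
    exact (abs_ksIter_succ_sub_le hξ hθ n k x).trans (le_of_eq (by ring))
  have h := dist_le_of_le_geometric_of_tendsto _ _ hθ hu (tendsto_ksIter hξ hθ k x) n
  rw [Real.dist_eq, abs_sub_comm] at h
  exact h.trans (le_of_eq (by ring))

/-- **The infinite-volume correlation functions are bounded**: `|g_k| ≤ ξ^k` (Ruelle (2.15) in the
density normalisation). [cite: Ruelle1969, §4.2.2 (2.15)] -/
theorem abs_ksCorr_le (k : ℕ) (x : Fin k → E) : |ksCorr ρ R k x| ≤ ξ ^ k :=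
  (isClosed_le continuous_abs continuous_const).mem_of_tendsto (tendsto_ksIter hξ hθ k x)
    (Eventually.of_forall fun n => abs_ksIter_le hξ hθ n k x)

/-- The infinite-volume correlation functions are measurable. [folklore] -/
theorem measurable_ksCorr (k : ℕ) : Measurable (ksCorr (E := E) ρ R k) :=
  measurable_of_tendsto_metrizable (fun n => measurable_ksIter hξ hθ n k)
    (tendsto_pi_nhds.2 fun x => tendsto_ksIter hξ hθ k x)

/-- **The infinite-volume correlation functions solve the Kirkwood–Salsburg equations.**
[cite: Ruelle1969, §4.2.3 Thm 4.2.3] -/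
theorem ksOp_ksCorr : ksOp ρ R (ksCorr (E := E) ρ R) = ksCorr ρ R := by
  funext k x
  set θ := ksRatio E ρ R ξ with hθdef
  have hθ0 : 0 ≤ θ := ksRatio_nonneg ρ R hξ.le
  have h1θ : 0 < 1 - θ := by linarith
  -- the bound `|T g − g| ≤ (θ · 2θⁿ/(1−θ) + 2θⁿ⁺¹/(1−θ)) ξ^k` for every `n`
  have hb : ∀ n : ℕ, |ksOp ρ R (ksCorr ρ R) k x - ksCorr ρ R k x| ≤
      (θ * (2 * θ ^ n / (1 - θ)) + 2 * θ ^ (n + 1) / (1 - θ)) * ξ ^ k := by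
    intro n
    have hg1 : ∀ k (y : Fin k → E), |ksCorr (E := E) ρ R k y| ≤ 1 * ξ ^ k := fun k y => by
      rw [one_mul]; exact abs_ksCorr_le hξ hθ k y
    have hi1 : ∀ k (y : Fin k → E), |ksIter (E := E) ρ R n k y| ≤ 1 * ξ ^ k := fun k y => by
      rw [one_mul]; exact abs_ksIter_le hξ hθ n k y
    have hc := abs_ksOp_sub_ksOp_le ρ R hξ (measurable_ksCorr hξ hθ) hg1 (measurable_ksIter hξ hθ n)
      hi1 (fun k y => abs_ksCorr_sub_ksIter_le hξ hθ n k y) k x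
    have hd := abs_ksCorr_sub_ksIter_le hξ hθ (n + 1) k x
    rw [ksIter_succ] at hd
    rw [abs_sub_comm] at hd
    calc |ksOp ρ R (ksCorr ρ R) k x - ksCorr ρ R k x|
        ≤ |ksOp ρ R (ksCorr ρ R) k x - ksOp ρ R (ksIter ρ R n) k x| +
            |ksOp ρ R (ksIter ρ R n) k x - ksCorr ρ R k x| := abs_sub_le _ _ _
      _ ≤ θ * (2 * θ ^ n / (1 - θ) * ξ ^ k) + 2 * θ ^ (n + 1) / (1 - θ) * ξ ^ k := add_le_add hc hd
      _ = (θ * (2 * θ ^ n / (1 - θ)) + 2 * θ ^ (n + 1) / (1 - θ)) * ξ ^ k := by ring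
  have ht : Tendsto (fun n : ℕ => (θ * (2 * θ ^ n / (1 - θ)) + 2 * θ ^ (n + 1) / (1 - θ)) * ξ ^ k)
      atTop (𝓝 ((θ * (2 * 0 / (1 - θ)) + 2 * 0 / (1 - θ)) * ξ ^ k)) := by
    have hp := tendsto_pow_atTop_nhds_zero_of_lt_one hθ0 hθ
    have hp1 : Tendsto (fun n : ℕ => θ ^ (n + 1)) atTop (𝓝 0) := by
      simpa [pow_succ] using hp.mul_const θ
    exact (((hp.const_mul 2).div_const _).const_mul θ |>.add ((hp1.const_mul 2).div_const _)).mul_const _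
  rw [show (θ * (2 * 0 / (1 - θ)) + 2 * 0 / (1 - θ)) * ξ ^ k = 0 by ring] at ht
  have h0 : |ksOp ρ R (ksCorr ρ R) k x - ksCorr ρ R k x| ≤ 0 :=
    le_of_tendsto_of_tendsto' tendsto_const_nhds ht hb
  exact sub_eq_zero.1 (abs_nonpos_iff.1 h0)

/-- **Stability / uniqueness estimate**: a measurable sequence in a weighted ball which solves
the equations up to `δ ξ^k` is within `δ (1 − θ)⁻¹ ξ^k` of the infinite-volume correlation
functions. [cite: Ruelle1969, §4.2.3 Thm 4.2.3] -/
theorem abs_sub_ksCorr_le {ψ : CorrSeq E} {C' δ : ℝ} (hψm : ∀ k, Measurable (ψ k))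
    (hψ : ∀ k (y : Fin k → E), |ψ k y| ≤ C' * ξ ^ k) (hδ : 0 ≤ δ)
    (happrox : ∀ k (y : Fin k → E), |ksOp ρ R ψ k y - ψ k y| ≤ δ * ξ ^ k) (k : ℕ) (x : Fin k → E) :
    |ψ k x - ksCorr ρ R k x| ≤ δ / (1 - ksRatio E ρ R ξ) * ξ ^ k := by
  set θ := ksRatio E ρ R ξ with hθdef
  have hθ0 : 0 ≤ θ := ksRatio_nonneg ρ R hξ.le
  have h1θ : 0 < 1 - θ := by linarith
  have hC' : 0 ≤ C' := by
    have h0 := hψ 0 (fun i => Fin.elim0 i)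
    rw [pow_zero, mul_one] at h0
    exact (abs_nonneg _).trans h0
  have hg1 : ∀ k (y : Fin k → E), |ksCorr (E := E) ρ R k y| ≤ 1 * ξ ^ k := fun k y => by
    rw [one_mul]; exact abs_ksCorr_le hξ hθ k y
  -- invariant: `|ψ − g| ≤ (δ/(1−θ) + θⁿ (C'+1)) ξ^k`
  have hind : ∀ n : ℕ, ∀ k (y : Fin k → E),
      |ψ k y - ksCorr ρ R k y| ≤ (δ / (1 - θ) + θ ^ n * (C' + 1)) * ξ ^ k := by
    intro n
    induction n with
    | zero =>
      intro k y
      calc |ψ k y - ksCorr ρ R k y| ≤ |ψ k y| + |ksCorr ρ R k y| := abs_sub _ _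
        _ ≤ C' * ξ ^ k + 1 * ξ ^ k := add_le_add (hψ k y) (hg1 k y)
        _ ≤ (δ / (1 - θ) + θ ^ 0 * (C' + 1)) * ξ ^ k := by
            rw [pow_zero, one_mul]
            nlinarith [div_nonneg hδ h1θ.le, pow_nonneg hξ.le k]
    | succ n ih =>
      intro k y
      have hc := abs_ksOp_sub_ksOp_le ρ R hξ hψm hψ (measurable_ksCorr hξ hθ) hg1 ih k y
      rw [ksOp_ksCorr hξ hθ] at hc
      calc |ψ k y - ksCorr ρ R k y|
          ≤ |ψ k y - ksOp ρ R ψ k y| + |ksOp ρ R ψ k y - ksCorr ρ R k y| := abs_sub_le _ _ _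
        _ ≤ δ * ξ ^ k + θ * ((δ / (1 - θ) + θ ^ n * (C' + 1)) * ξ ^ k) := by
            rw [abs_sub_comm]; exact add_le_add (happrox k y) hc
        _ = (δ / (1 - θ) + θ ^ (n + 1) * (C' + 1)) * ξ ^ k := by
            field_simp; ring
  have ht : Tendsto (fun n : ℕ => (δ / (1 - θ) + θ ^ n * (C' + 1)) * ξ ^ k) atTop
      (𝓝 ((δ / (1 - θ) + 0 * (C' + 1)) * ξ ^ k)) :=
    ((tendsto_pow_atTop_nhds_zero_of_lt_one hθ0 hθ).mul_const _ |>.const_add _).mul_const _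
  rw [zero_mul, add_zero] at ht
  exact le_of_tendsto_of_tendsto' tendsto_const_nhds ht fun n => hind n k x

/-- **Uniqueness** (Ruelle Thm 4.2.3): a bounded measurable solution of the Kirkwood–Salsburg
equations is the infinite-volume correlation sequence. [cite: Ruelle1969, §4.2.3 Thm 4.2.3] -/
theorem eq_ksCorr_of_fixed {ψ : CorrSeq E} {C' : ℝ} (hψm : ∀ k, Measurable (ψ k))
    (hψ : ∀ k (y : Fin k → E), |ψ k y| ≤ C' * ξ ^ k) (hfix : ksOp ρ R ψ = ψ) : ψ = ksCorr ρ R := by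
  funext k x
  have h := abs_sub_ksCorr_le hξ hθ hψm hψ le_rfl
    (fun k y => by rw [hfix, sub_self, abs_zero, zero_mul]) k x
  rw [zero_div, zero_mul] at h
  exact sub_eq_zero.1 (abs_nonpos_iff.1 h)

end FixedPoint


/-! ## Symmetries: invariance under volume-preserving isometries -/

/-- The componentwise action of a measurable automorphism of `E` on `n`-point configurations.
[folklore] -/
def piMap (e : E ≃ᵐ E) (n : ℕ) : (Fin n → E) ≃ᵐ (Fin n → E) :=
  MeasurableEquiv.piCongrRight fun _ => e

omit [NormedAddCommGroup E] [InnerProductSpace ℝ E] [FiniteDimensional ℝ E] [BorelSpace E] in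
/-- `piMap e n y = e ∘ y`. [folklore] -/
theorem piMap_apply (e : E ≃ᵐ E) (n : ℕ) (y : Fin n → E) : piMap e n y = e ∘ y := rfl

/-- The componentwise action of a volume-preserving automorphism preserves the product volume.
[folklore] -/
theorem measurePreserving_piMap (e : E ≃ᵐ E) (he : MeasurePreserving e volume volume) (n : ℕ) :
    MeasurePreserving (piMap e n) (volume : Measure (Fin n → E)) volume :=
  measurePreserving_pi (fun _ : Fin n => (volume : Measure E)) (fun _ => volume) fun _ => he

/-- **The Kirkwood–Salsburg operator commutes with volume-preserving isometries** of `E`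
(translations, rotations, reflections). [folklore] -/
theorem ksOp_comp (ρ R : ℝ) (e : E ≃ᵐ E) (he : MeasurePreserving e volume volume)
    (hdist : ∀ a b : E, dist (e a) (e b) = dist a b) (φ : CorrSeq E) (k : ℕ) (x : Fin k → E) :
    ksOp ρ R (fun k y => φ k (e ∘ y)) k x = ksOp ρ R φ k (e ∘ x) := by
  cases k with
  | zero => rfl
  | succ m =>
    rw [ksOp_succ, ksOp_succ]
    have hw : wall (e ∘ x) = wall x := by simp only [wall, Function.comp_apply, hdist]
    rw [hw]
    congr 1
    refine tsum_congr fun n => ?_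
    unfold ksTerm
    congr 1
    calc ∫ y, ksIntegrand (fun k y => φ k (e ∘ y)) m n x y
        = ∫ y, ksIntegrand φ m n (e ∘ x) (piMap e n y) := by
          refine integral_congr_ae (Eventually.of_forall fun y => ?_)
          simp only [ksIntegrand, piMap_apply]
          congr 1
          · simp only [ballProd, Function.comp_apply, hdist]
          · -- `e ∘ (u ++ v) = (e ∘ u) ++ (e ∘ v)` (cf. `Literature.Geometry.Kaehler.comp_fin_append`)
            have hca : e ∘ Fin.append (Fin.tail x) y = Fin.append (e ∘ Fin.tail x) (e ∘ y) := by
              funext i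
              refine Fin.addCases (fun j => ?_) (fun j => ?_) i <;> simp
            rw [hca, Fin.comp_tail]
      _ = ∫ y, ksIntegrand φ m n (e ∘ x) y :=
          (measurePreserving_piMap e he n).integral_comp' (ksIntegrand φ m n (e ∘ x))

section Symmetry

variable {ρ R ξ : ℝ} (hξ : 0 < ξ) (hθ : ksRatio E ρ R ξ < 1)
include hξ hθ

/-- **Invariance of the infinite-volume correlation functions under volume-preserving isometries**
(uniqueness of the fixed point). [cite: Ruelle1969, §4.2.3 Thm 4.2.3] -/
theorem ksCorr_comp (e : E ≃ᵐ E) (he : MeasurePreserving e volume volume)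
    (hdist : ∀ a b : E, dist (e a) (e b) = dist a b) (k : ℕ) (x : Fin k → E) :
    ksCorr ρ R k (e ∘ x) = ksCorr ρ R k x := by
  have hfix : ksOp ρ R (fun k y => ksCorr (E := E) ρ R k (e ∘ y)) =
      fun k y => ksCorr (E := E) ρ R k (e ∘ y) := by
    funext k y
    rw [ksOp_comp ρ R e he hdist, ksOp_ksCorr hξ hθ]
  have hm : ∀ k, Measurable fun y : Fin k → E => ksCorr (E := E) ρ R k (e ∘ y) := fun k =>
    (measurable_ksCorr hξ hθ k).comp (piMap e k).measurable
  have hb : ∀ k (y : Fin k → E), |ksCorr (E := E) ρ R k (e ∘ y)| ≤ 1 * ξ ^ k := fun k y => by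
    rw [one_mul]; exact abs_ksCorr_le hξ hθ k _
  exact congrFun (congrFun (eq_ksCorr_of_fixed hξ hθ hm hb hfix) k) x

/-- **Translation invariance** of the infinite-volume correlation functions.
[cite: Ruelle1969, §4.2.3 Thm 4.2.3] -/
theorem ksCorr_const_add (a : E) (k : ℕ) (x : Fin k → E) :
    ksCorr ρ R k (fun i => a + x i) = ksCorr ρ R k x :=
  ksCorr_comp hξ hθ (MeasurableEquiv.addLeft a) (measurePreserving_add_left volume a)
    (fun b c => by simp) k x

/-- **Isotropy**: invariance of the infinite-volume correlation functions under linear isometries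
(rotations and reflections). [cite: Ruelle1969, §4.2.3 Thm 4.2.3] -/
theorem ksCorr_linearIsometryEquiv (f : E ≃ₗᵢ[ℝ] E) (k : ℕ) (x : Fin k → E) :
    ksCorr ρ R k (fun i => f (x i)) = ksCorr ρ R k x :=
  ksCorr_comp hξ hθ f.toMeasurableEquiv f.measurePreserving (fun b c => f.dist_map b c) k x

end Symmetry

/-! ## Continuity in the parameters `(ρ, R)` -/

/-- `|a^n − b^n| ≤ |a − b| (max |a| |b| + 1)^n`. [folklore] -/
theorem abs_pow_sub_pow_le_mul_pow (a b : ℝ) (n : ℕ) :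
    |a ^ n - b ^ n| ≤ |a - b| * (max |a| |b| + 1) ^ n := by
  set M := max |a| |b| with hM
  have hM0 : 0 ≤ M := le_max_of_le_left (abs_nonneg a)
  have ha : |a| ≤ M := le_max_left _ _
  have hb : |b| ≤ M := le_max_right _ _
  induction n with
  | zero => simp
  | succ n ih =>
    have hbn : |b| ^ n ≤ (M + 1) ^ n := pow_le_pow_left₀ (abs_nonneg b) (by linarith) n
    calc |a ^ (n + 1) - b ^ (n + 1)| = |a * (a ^ n - b ^ n) + (a - b) * b ^ n| := by
          congr 1; ring
      _ ≤ |a| * |a ^ n - b ^ n| + |a - b| * |b| ^ n := by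
          refine (abs_add_le _ _).trans (le_of_eq ?_)
          rw [abs_mul, abs_mul, abs_pow]
      _ ≤ M * (|a - b| * (M + 1) ^ n) + |a - b| * (M + 1) ^ n := by gcongr
      _ = |a - b| * (M + 1) ^ (n + 1) := by ring

/-- **Lipschitz dependence of the operator on the density**: the `n`-th terms at densities `ρ, ρ'`
differ by at most `|ρ − ρ'| (ρ̄ + 1)^n v₁^n /n! · sup|φ_{m+n}|`, `ρ̄ = max |ρ| |ρ'|`. [folklore] -/
theorem abs_ksTerm_sub_ksTerm_le (ρ ρ' : ℝ) {φ : CorrSeq E} {m n : ℕ} {M : ℝ}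
    (hM : ∀ y, |φ (m + n) y| ≤ M) (x : Fin (m + 1) → E) :
    |ksTerm ρ φ m n x - ksTerm ρ' φ m n x| ≤
      |ρ - ρ'| * ((max |ρ| |ρ'| + 1) ^ n / (Nat.factorial n : ℝ)) * (v1 E ^ n * M) := by
  unfold ksTerm ksIntegrand
  rw [← sub_mul, abs_mul, ← sub_div, abs_div, Nat.abs_cast]
  have h1 : |(-ρ) ^ n - (-ρ') ^ n| ≤ |ρ - ρ'| * (max |ρ| |ρ'| + 1) ^ n := by
    have h := abs_pow_sub_pow_le_mul_pow (-ρ) (-ρ') n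
    rwa [abs_neg, abs_neg, show -ρ - -ρ' = -(ρ - ρ') by ring, abs_neg] at h
  have hM0 : 0 ≤ M := (abs_nonneg _).trans (hM (Fin.append (Fin.tail x) fun i => x 0))
  calc |(-ρ) ^ n - (-ρ') ^ n| / (Nat.factorial n : ℝ) *
        |∫ y : Fin n → E, ballProd (x 0) y * φ (m + n) (Fin.append (Fin.tail x) y)|
      ≤ |ρ - ρ'| * (max |ρ| |ρ'| + 1) ^ n / (Nat.factorial n : ℝ) * (v1 E ^ n * M) :=
        mul_le_mul (div_le_div_of_nonneg_right h1 (by positivity))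
          (abs_integral_ballProd_mul_le (x 0) fun y => hM _) (abs_nonneg _) (by positivity)
    _ = |ρ - ρ'| * ((max |ρ| |ρ'| + 1) ^ n / (Nat.factorial n : ℝ)) * (v1 E ^ n * M) := by ring

/-- **Lipschitz dependence of the operator on `(ρ, R)`** on a weighted ball, pointwise form:
`|(T_{ρ,R} φ)_k − (T_{ρ',R'} φ)_k| ≤ (|R − R'| + |R'| |ρ − ρ'|) ξ⁻¹ exp((ρ̄+1) v₁ ξ) · C ξ^k`.
[folklore] -/
theorem abs_ksOp_sub_ksOp_param_le (ρ ρ' R R' : ℝ) {φ : CorrSeq E} {ξ C : ℝ} (hξ : 0 < ξ)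
    (hφ : ∀ k (y : Fin k → E), |φ k y| ≤ C * ξ ^ k) (k : ℕ) (x : Fin k → E) :
    |ksOp ρ R φ k x - ksOp ρ' R' φ k x| ≤
      (|R - R'| + |R'| * |ρ - ρ'|) * ξ⁻¹ * Real.exp ((max |ρ| |ρ'| + 1) * v1 E * ξ) * (C * ξ ^ k) := by
  have hC : 0 ≤ C := by
    have h0 := hφ 0 (fun i => Fin.elim0 i)
    rw [pow_zero, mul_one] at h0
    exact (abs_nonneg _).trans h0
  cases k with
  | zero =>
    simp only [ksOp_zero, sub_self, abs_zero]
    positivity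
  | succ m =>
    set ρb := max |ρ| |ρ'| + 1 with hρb
    have hρb0 : 0 ≤ ρb := by positivity
    have hρ1 : |ρ| ≤ ρb := by rw [hρb]; linarith [le_max_left |ρ| |ρ'|]
    -- the two series
    have hS := summable_ksTerm ρ hφ m x
    have hS' := summable_ksTerm ρ' hφ m x
    -- bound on `∑ ksTerm ρ`
    have hA : |∑' n, ksTerm ρ φ m n x| ≤ C * ξ ^ m * Real.exp (ρb * v1 E * ξ) :=
      (abs_tsum_ksTerm_le ρ hφ m x).trans (mul_le_mul_of_nonneg_left
        (Real.exp_le_exp.2 (mul_le_mul_of_nonneg_right (mul_le_mul_of_nonneg_right hρ1 v1_nonneg)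
          hξ.le)) (by positivity))
    -- bound on the difference of the series
    have hB : |∑' n, ksTerm ρ φ m n x - ∑' n, ksTerm ρ' φ m n x| ≤
        |ρ - ρ'| * (C * ξ ^ m * Real.exp (ρb * v1 E * ξ)) := by
      rw [← hS.tsum_sub hS']
      have hmaj : HasSum (fun n : ℕ => |ρ - ρ'| * (C * ξ ^ m * ((|ρb| * v1 E * ξ) ^ n /
          (Nat.factorial n : ℝ)))) (|ρ - ρ'| * (C * ξ ^ m * Real.exp (|ρb| * v1 E * ξ))) :=
        (hasSum_majorant ρb ξ C m).mul_left _
      rw [abs_of_nonneg hρb0] at hmaj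
      have h := tsum_of_norm_bounded hmaj fun n => by
        rw [Real.norm_eq_abs]
        refine (abs_ksTerm_sub_ksTerm_le ρ ρ' (fun y => hφ (m + n) y) x).trans (le_of_eq ?_)
        rw [← hρb, pow_add, mul_pow, mul_pow]; ring
      rwa [Real.norm_eq_abs] at h
    rw [ksOp_succ, ksOp_succ]
    have hsplit : R * wall x * ∑' n, ksTerm ρ φ m n x - R' * wall x * ∑' n, ksTerm ρ' φ m n x =
        (R - R') * wall x * ∑' n, ksTerm ρ φ m n x +
          R' * wall x * (∑' n, ksTerm ρ φ m n x - ∑' n, ksTerm ρ' φ m n x) := by ring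
    rw [hsplit]
    calc |(R - R') * wall x * ∑' n, ksTerm ρ φ m n x +
          R' * wall x * (∑' n, ksTerm ρ φ m n x - ∑' n, ksTerm ρ' φ m n x)|
        ≤ |R - R'| * |wall x| * |∑' n, ksTerm ρ φ m n x| +
            |R'| * |wall x| * |∑' n, ksTerm ρ φ m n x - ∑' n, ksTerm ρ' φ m n x| := by
          refine (abs_add_le _ _).trans (le_of_eq ?_)
          rw [abs_mul, abs_mul, abs_mul, abs_mul]
      _ ≤ |R - R'| * 1 * (C * ξ ^ m * Real.exp (ρb * v1 E * ξ)) +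
            |R'| * 1 * (|ρ - ρ'| * (C * ξ ^ m * Real.exp (ρb * v1 E * ξ))) := by
          gcongr
          · exact abs_wall_le_one x
          · exact abs_wall_le_one x
      _ = (|R - R'| + |R'| * |ρ - ρ'|) * ξ⁻¹ * Real.exp (ρb * v1 E * ξ) * (C * ξ ^ (m + 1)) := by
          field_simp; ring

section Parameters

variable {ρ ρ' R R' ξ : ℝ} (hξ : 0 < ξ) (hθ : ksRatio E ρ R ξ < 1)
  (hθ' : ksRatio E ρ' R' ξ < 1)
include hξ hθ hθ'

/-- **Lipschitz continuity of the infinite-volume correlation functions in `(ρ, R)`** in Ruelle's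
weighted sup-norm: `|g^{ρ,R}_k − g^{ρ',R'}_k| ≤ (|R−R'| + |R'||ρ−ρ'|) ξ⁻¹ e^{(ρ̄+1)v₁ξ} (1−θ)⁻¹ ξ^k`.
[cite: Ruelle1969, §4.2.3 Thm 4.2.3] -/
theorem abs_ksCorr_sub_ksCorr_le (k : ℕ) (x : Fin k → E) :
    |ksCorr ρ' R' k x - ksCorr ρ R k x| ≤
      (|R - R'| + |R'| * |ρ - ρ'|) * ξ⁻¹ * Real.exp ((max |ρ| |ρ'| + 1) * v1 E * ξ) /
        (1 - ksRatio E ρ R ξ) * ξ ^ k := by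
  have hg' : ∀ k (y : Fin k → E), |ksCorr (E := E) ρ' R' k y| ≤ 1 * ξ ^ k := fun k y => by
    rw [one_mul]; exact abs_ksCorr_le hξ hθ' k y
  refine abs_sub_ksCorr_le hξ hθ (measurable_ksCorr hξ hθ') hg' (by positivity)
    (fun k y => ?_) k x
  have h := abs_ksOp_sub_ksOp_param_le ρ ρ' R R' hξ hg' k y
  rw [congrFun (congrFun (ksOp_ksCorr hξ hθ') k) y, one_mul] at h
  exact h

end Parameters

end HardSphereKS

end Literature.MathematicalPhysics.StatisticalMechanics
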